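/-
Copyright: harness cell b2b-lgcu-borel (gen 19).  Honest framing: the VALUE here is a THEOREM
(structural laws on every hypothetical witness of the crux) — NOT summit progress; the crux item
`SubgroupIdentityDesigns` (stmt-MatrixMultiplication-14079) stays open and untouched.
-/
import Mathlib
import Summits.MatrixMultiplication.MatrixMultiplication.Theorems.SubgroupIdentityDesigns.Negative.WitnessNeumannCounts
import Summits.MatrixMultiplication.MatrixMultiplication.Theorems.SubgroupIdentityDesigns.Negative.LevelOneFloorAll

/-!
# The level-one member window in every dimension (`p ≥ 3`)

Route `LevelGradedCohnUmans`, crux `SubgroupIdentityDesigns`, negative side; level `k = 1`,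
dimension `m = 1 + l` (`l ≥ 1`), odd primes `p`, exponents `−2 < ε ≤ 1`.

`levelOne_member_window` : for a subgroup-TPP triple of `GL_{1+l}(𝔽_p)` carrying a level-one
identity design and satisfying the crux inequality, with `b = (p^{1+l} − 1)/(p − 1)` and
`D = dim F_1|_G ≤ (p−1) b² − 2b + 2` (`LevelOneFloorAll`):
**every member has `b ≤ |Hᵢ| ≤ p^{1+l} − 3`**, and the OUTER members satisfy
**`(2b − 1)|H₁| ≤ D` and `(2b − 1)|H₃| ≤ D`** (about half of `p^{1+l}`) — from the two graded
Neumann counts (`WitnessNeumannCounts.crux_neumann`), the pair walls and the master floor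
`V > (p−1) b³ − 3b² + 3b`.  For `l = 1` it contains the window `p + 1 ≤ |Hᵢ| ≤ p² − 3` of
`LevelOneFloor.levelOne_witness_window`.  Corollary `not_transitive_member` : no member of a
level-one witness (nor any subgroup of one) acts transitively on the non-zero vectors of
`𝔽_p^{1+l}` — which retires, for `ε ≤ 1`, the vector-transitive members (Singer cycles,
`SL`, `Sp`, …) in every dimension at once.

Honest framing: VALUE = THEOREM, NOT summit progress; the crux stays open.  Sorry-free; standard
axioms; no new definitions.  Report: `run/shared/lean/b2b/levelgraded-cu/ORACLE-g19.md` §G19-2.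
-/

set_option linter.dupNamespace false

noncomputable section

open scoped BigOperators Classical Matrix
open Module (finrank)

namespace Summit.MatrixMultiplication.MatrixMultiplication.Theorems.SubgroupIdentityDesigns.Negative
namespace LevelOneWindowAll

open Literature.Barriers.MatrixMultiplication (SubgroupTPP)
open Summit.MatrixMultiplication.MatrixMultiplication.Theorems.LieRankDesigns.Negative
  (GLm Mat budget)
open Summit.MatrixMultiplication.MatrixMultiplication.Theorems.LevelOneGL2Designs.Negative
  (levelSubmodule)
open WitnessNeumannCounts (crux_neumann volume_law_of_counts one_le_card)
open LevelOneFloorAll (volume_gt_floor_nat finrank_le_formula_nat succ_le_b sub_one_mul_b)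

section LevelOne

variable {p : ℕ} [hp : Fact p.Prime] {l : ℕ}

omit hp in
/-- Window arithmetic, lower end: `D + 2b ≤ (p−1) b² + 2`, `s ≤ D` and
`(p−1) b³ + 3b + 1 ≤ t s + 3 b²` force `b ≤ t` (`p ≥ 3`, `b ≥ 4`). -/
theorem le_of_floor_wall {p b D t s : ℕ} (hp3 : 3 ≤ p) (hb4 : 4 ≤ b)
    (hD : D + 2 * b ≤ (p - 1) * b ^ 2 + 2) (hs : s ≤ D)
    (hts : (p - 1) * b ^ 3 + 3 * b + 1 ≤ t * s + 3 * b ^ 2) : b ≤ t := by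
  by_contra h
  push Not at h
  have hb1 : 1 ≤ b := by omega
  have hp1 : 1 ≤ p := by omega
  have h1 : t * s ≤ (b - 1) * D := Nat.mul_le_mul (by omega) hs
  have h2 : (b - 1) * (D + 2 * b) ≤ (b - 1) * ((p - 1) * b ^ 2 + 2) := Nat.mul_le_mul_left _ hD
  zify [hb1, hp1] at h1 h2 hts
  have hp3R : (0 : ℤ) ≤ (p : ℤ) - 3 := by
    have : (3 : ℤ) ≤ p := by exact_mod_cast hp3
    linarith
  have hb4R : (4 : ℤ) ≤ b := by exact_mod_cast hb4
  nlinarith [h1, h2, hts, mul_nonneg hp3R (sq_nonneg (b : ℤ)), hb4R]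

omit hp in
/-- Window arithmetic, upper end: `(p−1) b = P − 1`, `D + 2b ≤ (p−1) b² + 2`, `b ≤ s` and
`t s ≤ D` force `t + 3 ≤ P` (`b ≥ 4`). -/
theorem add_three_le_of_wall {p b D t s P : ℕ} (hb4 : 4 ≤ b) (hp1 : 1 ≤ p)
    (hP : (p - 1) * b = P - 1) (hD : D + 2 * b ≤ (p - 1) * b ^ 2 + 2) (hs : b ≤ s)
    (hts : t * s ≤ D) : t + 3 ≤ P := by
  have h1 : t * b ≤ D := le_trans (Nat.mul_le_mul_left _ hs) hts
  by_contra h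
  push Not at h
  have ht : (p - 1) * b ≤ t + 1 := by
    rw [hP]
    omega
  have h2 : ((p - 1) * b) * b ≤ (t + 1) * b := Nat.mul_le_mul_right _ ht
  have hb1 : 1 ≤ b := by omega
  zify [hb1, hp1] at h1 h2 hD
  have hb4R : (4 : ℤ) ≤ b := by exact_mod_cast hb4
  nlinarith [h1, h2, hD, hb4R]

/-! ## The window -/

/-- **THE LEVEL-ONE MEMBER WINDOW IN EVERY DIMENSION** (`p ≥ 3`, `l ≥ 1`, `−2 < ε ≤ 1`).  For a
subgroup-TPP triple of `GL_{1+l}(𝔽_p)` carrying a level-one identity design and satisfying the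
crux inequality, with `b = (p^{1+l} − 1)/(p − 1)` and `D = dim F_1|_G ≤ (p−1) b² − 2b + 2`:
every member has `b ≤ |Hᵢ|` and `|Hᵢ| + 3 ≤ p^{1+l}`, and the outer members satisfy
`(2b − 1)|H₁| ≤ D`, `(2b − 1)|H₃| ≤ D`. -/
theorem levelOne_member_window (hl : 1 ≤ l) (hp3 : 3 ≤ p) {ε : ℝ} (hε : -2 < ε) (hε1 : ε ≤ 1)
    {H₁ H₂ H₃ : Subgroup (GLm p (1 + l))} (htpp : SubgroupTPP H₁ H₂ H₃)
    (hdes : ∃ c : Mat p (1 + l) → ℂ, (∀ M, 1 < M.rank → c M = 0) ∧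
      (∑ M, c M * ZMod.stdAddChar (Matrix.trace (M * ((1 : GLm p (1 + l)) : Mat p (1 + l))))) = 1 ∧
      ∀ a ∈ H₁, ∀ b ∈ H₂, ∀ g ∈ H₃, a * b * g ≠ 1 →
        (∑ M, c M * ZMod.stdAddChar
          (Matrix.trace (M * ((a * b * g : GLm p (1 + l)) : Mat p (1 + l))))) = 0)
    (hlt : budget p (1 + l) 1 (2 + ε) <
      ((Nat.card H₁ * Nat.card H₂ * Nat.card H₃ : ℕ) : ℝ) ^ ((2 + ε) / 3)) :
    ((p ^ (1 + l) - 1) / (p - 1) ≤ Nat.card H₁ ∧ Nat.card H₁ + 3 ≤ p ^ (1 + l) ∧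
        (2 * ((p ^ (1 + l) - 1) / (p - 1)) - 1) * Nat.card H₁ ≤
          finrank ℂ (levelSubmodule p (1 + l) 1)) ∧
      ((p ^ (1 + l) - 1) / (p - 1) ≤ Nat.card H₂ ∧ Nat.card H₂ + 3 ≤ p ^ (1 + l)) ∧
      ((p ^ (1 + l) - 1) / (p - 1) ≤ Nat.card H₃ ∧ Nat.card H₃ + 3 ≤ p ^ (1 + l) ∧
        (2 * ((p ^ (1 + l) - 1) / (p - 1)) - 1) * Nat.card H₃ ≤
          finrank ℂ (levelSubmodule p (1 + l) 1)) := by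
  obtain ⟨N1, N2⟩ := crux_neumann (k := 1) htpp hdes
  obtain ⟨⟨w12, w23, w13⟩, -⟩ :=
    volume_law_of_counts (one_le_card H₁) (one_le_card H₂) (one_le_card H₃) N1 N2
  have hF := volume_gt_floor_nat (p := p) hl hε hε1 hlt
  have hD := finrank_le_formula_nat (p := p) (l := l)
  have hbp := succ_le_b (p := p) hl
  have hP : (p - 1) * ((p ^ (1 + l) - 1) / (p - 1)) = p ^ (1 + l) - 1 := sub_one_mul_b
  have hb4 : 4 ≤ (p ^ (1 + l) - 1) / (p - 1) := by omega
  have hp1 : 1 ≤ p := by omega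
  have hy1 : 1 ≤ Nat.card H₂ := one_le_card H₂
  -- lower ends
  have hxb : (p ^ (1 + l) - 1) / (p - 1) ≤ Nat.card H₁ :=
    le_of_floor_wall hp3 hb4 hD w23 (by rw [← mul_assoc]; exact hF)
  have hyb : (p ^ (1 + l) - 1) / (p - 1) ≤ Nat.card H₂ :=
    le_of_floor_wall hp3 hb4 hD w13 (by rw [mul_left_comm, ← mul_assoc]; exact hF)
  have hzb : (p ^ (1 + l) - 1) / (p - 1) ≤ Nat.card H₃ :=
    le_of_floor_wall hp3 hb4 hD w12 (by
      have e : Nat.card H₃ * (Nat.card H₁ * Nat.card H₂) =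
          Nat.card H₁ * Nat.card H₂ * Nat.card H₃ := by ring
      rw [e]; exact hF)
  -- upper ends
  have hxu : Nat.card H₁ + 3 ≤ p ^ (1 + l) := add_three_le_of_wall hb4 hp1 hP hD hyb w12
  have hyu : Nat.card H₂ + 3 ≤ p ^ (1 + l) := add_three_le_of_wall hb4 hp1 hP hD hzb w23
  have hzu : Nat.card H₃ + 3 ≤ p ^ (1 + l) :=
    add_three_le_of_wall hb4 hp1 hP hD hxb (by rw [mul_comm]; exact w13)
  -- outer members: `x (z + y - 1) ≤ D`, `(x + y - 1) z ≤ D` with `x, y, z ≥ b`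
  have hxo : (2 * ((p ^ (1 + l) - 1) / (p - 1)) - 1) * Nat.card H₁ ≤
      finrank ℂ (levelSubmodule p (1 + l) 1) := by
    have h2 : 2 * ((p ^ (1 + l) - 1) / (p - 1)) - 1 ≤ Nat.card H₃ + (Nat.card H₂ - 1) := by omega
    calc (2 * ((p ^ (1 + l) - 1) / (p - 1)) - 1) * Nat.card H₁
        = Nat.card H₁ * (2 * ((p ^ (1 + l) - 1) / (p - 1)) - 1) := mul_comm _ _
      _ ≤ Nat.card H₁ * (Nat.card H₃ + (Nat.card H₂ - 1)) := Nat.mul_le_mul_left _ h2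
      _ = Nat.card H₁ * Nat.card H₃ + Nat.card H₁ * (Nat.card H₂ - 1) := mul_add _ _ _
      _ ≤ _ := N1
  have hzo : (2 * ((p ^ (1 + l) - 1) / (p - 1)) - 1) * Nat.card H₃ ≤
      finrank ℂ (levelSubmodule p (1 + l) 1) := by
    have h2 : 2 * ((p ^ (1 + l) - 1) / (p - 1)) - 1 ≤ Nat.card H₁ + (Nat.card H₂ - 1) := by omega
    calc (2 * ((p ^ (1 + l) - 1) / (p - 1)) - 1) * Nat.card H₃
        ≤ (Nat.card H₁ + (Nat.card H₂ - 1)) * Nat.card H₃ := Nat.mul_le_mul_right _ h2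
      _ = Nat.card H₁ * Nat.card H₃ + (Nat.card H₂ - 1) * Nat.card H₃ := add_mul _ _ _
      _ ≤ _ := N2
  exact ⟨⟨hxb, hxu, hxo⟩, ⟨hyb, hyu⟩, ⟨hzb, hzu, hzo⟩⟩

/-- **NO MEMBER OF A LEVEL-ONE WITNESS IS TRANSITIVE ON NON-ZERO VECTORS** (`p ≥ 3`, `l ≥ 1`,
`−2 < ε ≤ 1`): `|Hᵢ| ≤ p^{1+l} − 3 < p^{1+l} − 1 = #(𝔽_p^{1+l} ∖ 0)`, so no member maps a fixed
non-zero vector onto every non-zero vector. -/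
theorem not_transitive_member (hl : 1 ≤ l) (hp3 : 3 ≤ p) {ε : ℝ} (hε : -2 < ε) (hε1 : ε ≤ 1)
    {H₁ H₂ H₃ : Subgroup (GLm p (1 + l))} (htpp : SubgroupTPP H₁ H₂ H₃)
    (hdes : ∃ c : Mat p (1 + l) → ℂ, (∀ M, 1 < M.rank → c M = 0) ∧
      (∑ M, c M * ZMod.stdAddChar (Matrix.trace (M * ((1 : GLm p (1 + l)) : Mat p (1 + l))))) = 1 ∧
      ∀ a ∈ H₁, ∀ b ∈ H₂, ∀ g ∈ H₃, a * b * g ≠ 1 →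
        (∑ M, c M * ZMod.stdAddChar
          (Matrix.trace (M * ((a * b * g : GLm p (1 + l)) : Mat p (1 + l))))) = 0)
    (hlt : budget p (1 + l) 1 (2 + ε) <
      ((Nat.card H₁ * Nat.card H₂ * Nat.card H₃ : ℕ) : ℝ) ^ ((2 + ε) / 3))
    (H : Subgroup (GLm p (1 + l))) (hH : H ≤ H₁ ∨ H ≤ H₂ ∨ H ≤ H₃)
    (a₀ : Fin (1 + l) → ZMod p) :
    ∃ v : Fin (1 + l) → ZMod p, v ≠ 0 ∧
      ∀ h ∈ H, ((h : GLm p (1 + l)) : Mat p (1 + l)).mulVec a₀ ≠ v := by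
  obtain ⟨⟨-, hxu, -⟩, ⟨-, hyu⟩, ⟨-, hzu, -⟩⟩ := levelOne_member_window hl hp3 hε hε1 htpp hdes hlt
  have hHc : Nat.card H + 3 ≤ p ^ (1 + l) := by
    rcases hH with h | h | h
    · exact le_trans (Nat.add_le_add_right (Subgroup.card_le_of_le h) 3) hxu
    · exact le_trans (Nat.add_le_add_right (Subgroup.card_le_of_le h) 3) hyu
    · exact le_trans (Nat.add_le_add_right (Subgroup.card_le_of_le h) 3) hzu
  classical
  by_contra hcon
  push Not at hcon
  -- every non-zero vector is some `h a₀`: the image of `h ↦ h a₀` contains `univ.erase 0`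
  set img : Finset (Fin (1 + l) → ZMod p) := (Finset.univ : Finset H).image
    (fun h : H => ((h : GLm p (1 + l)) : Mat p (1 + l)).mulVec a₀) with himg
  have hsub : (Finset.univ : Finset (Fin (1 + l) → ZMod p)).erase 0 ⊆ img := by
    intro v hv
    rw [Finset.mem_erase] at hv
    obtain ⟨h, hh, e⟩ := hcon v hv.1
    exact Finset.mem_image.2 ⟨⟨h, hh⟩, Finset.mem_univ _, e⟩
  have h1 : ((Finset.univ : Finset (Fin (1 + l) → ZMod p)).erase 0).card = p ^ (1 + l) - 1 := by
    rw [Finset.card_erase_of_mem (Finset.mem_univ _), Finset.card_univ, Fintype.card_fun,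
      ZMod.card, Fintype.card_fin]
  have h2 : img.card ≤ Nat.card H := by
    rw [Nat.card_eq_fintype_card, ← Finset.card_univ]
    exact Finset.card_image_le
  have h3 := Finset.card_le_card hsub
  omega

end LevelOne

end LevelOneWindowAll

end Summit.MatrixMultiplication.MatrixMultiplication.Theorems.SubgroupIdentityDesigns.Negative
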